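import Literature.NumberTheory.Rogawski1990.ArchStableSumGWeyl            -- ★-cand PART 1∕2 (this seat): `stableSumG`, `stableTwistG`, `StInRegG`, `ArchHcStableWeyl`, `archHcStableWeyl_stableSumG`, (P)∕(I₄) inheritance
import Literature.NumberTheory.Rogawski1990.ArchTransfFamilyResolved      -- ★ (LH3-p04): `exists_continuousLinearEquiv_eq_slotPerm`, `continuous_slotPerm`; brings ★ `contDiff_coord`, `contDiff_cexp_comp`
import Literature.NumberTheory.Rogawski1990.ArchBouazizWallSetJetBound    -- ★ (LH3-p01): `norm_iteratedFDeriv_comp_clm_add_le`, `norm_iteratedFDeriv_mul_le_of_isOpen` (generic jet bounds on an open set)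
import HarnessLib

/-!
# The stable sum of a Harish-Chandra family: (P), (W^st), (I₄), smoothness on the STABLE in-regular set `StInRegG` and bounded jets there
# — brick (2) «STABLE-SUM-G» FILE 2, option (A) «IMAGE» (Bouaziz 1994 §3.1–3.2 (I₁)(I₂), §6.2 p. 591; Shelstad 1979 §4 pp. 22–26)

Topic `NumberTheory/Rogawski1990`; namespace `Literature.NumberTheory.Rogawski1990`.  THEOREMS ONLY (no definition, no instance, no notation, no axiom, no named fact, no `sorry`).
Cell `pub/hodgecm-mathlib`, crux H413 = `stmt-HodgeConjecture-24833`, road «N8-INNER» (row 2 `stub_N8`), dealer LH2-plan (g1) DEAL #1 brick (2), RULING «(A) IMAGE» 2026-09-02T15:46:22Z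
((D2) v2 of record: the STABLE HC SPACE of the `β`-atlas := the IMAGE `{stableSumG F | F ∈ ArchHCSpaceG (slotSign L β) jc′}`; every junction brick works with ORDINARY members and
applies ★-cand `stableSumG` at the end); seat LH10-p02 (g9).

WHAT IS PROVED (generic `W`, any sign pattern `s`, any constants `jc′`).  For a member `F` of ★ `ArchHCSpaceG s jc′` — indeed for any family with the relevant conjunct — the stable
sum ★-cand `stableSumG F` (PART 1: `Σ_{ρ ∈ partnerPerms S′} u_ρ(c) · F S′ (slotPerm ρ c)`, the alternating Weyl sum in the twisted currency) satisfies: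
* §1 the pieces are smooth: `isOpen_stInRegG`, `contDiff_slotPerm`, `contDiff_stableTwistG` (the unit twist is entire: a product of `e^{i·(linear)}`), `stInRegG_mapsTo_inRegG_slotPerm`.
* §2 **`contDiffOn_stableSumG`** — (I₂)^st: `stableSumG F S′` is `C^∞` on ★-cand `StInRegG S′` (ALL imaginary walls removed, real walls kept) as soon as every `F S′` is `C^∞` on
  `InRegG s S′` (each partner point of a stable-in-regular point is in-regular for every `s`).
* §3 **`bddAbove_norm_iteratedFDeriv_stableSumG`** — (I₁)^st: every jet of `stableSumG F S′` is bounded on `K ∩ StInRegG S′` for every compact `K`, from the same bounds for `F` on the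
  compact partner images `slotPerm ρ '' K` (Leibniz with the entire unit ★ `norm_iteratedFDeriv_mul_le_of_isOpen`, linear pull-back ★ `norm_iteratedFDeriv_comp_clm_add_le` along
  ★ `exists_continuousLinearEquiv_eq_slotPerm`, the sum rule on the open set).
* §4 **`stableSumG_clauses_of_archHCSpaceG`** — the package for a member: (P) (★-cand `archHcPeriodic_stableSumG`), (W^st) (★-cand `archHcStableWeyl_stableSumG`, from (W)'s
  `x`-evenness), (I₄) (★-cand `archHcCompactSupport_stableSumG`), §2 and §3.
WHAT IS NOT CLAIMED — THE NEGATIVE REMARK OF RECORD (SIGSHEET v1 §2, this seat; dealer ruling 15:46:22Z «correct and adopted»; (6) LH3-p03 (g7) independently).  `stableSumG F` is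
NOT a member of `ArchHCSpaceG s jc′`: (F1) its (W^st)-symmetry makes EVERY imaginary wall a jump wall — at a point of a COMPACT wall `{c w 0 = c w 1}` (`s w = (+,+,−)`) the partner term
`F S′ (hcSwapAt w 0 2 c)` sits on the NONCOMPACT wall `{slot 1 = slot 2}` and jumps by ★ `ArchHcJump.order_zero`, and the coset bookkeeping gives a total jump `−2·jc′·X` (3-term
reading) ∕ `−4·jc′·X` (full `S₃`) under the relations (W)+(I₃) force on live constants — so clause (I₁I₂) `ContDiffOn … (InRegG s S′)` FAILS for the stable sum (this is why §2–§3 are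
stated on `StInRegG`, Bouaziz's `T^st_{in-reg}`); (F2) at a genuinely noncompact wall the jump constant of the stable sum is `jc′(i,j) − jc′(j,i) = 2·jc′(i,j)`, not `jc′(i,j)` (SL₂ check:
`F(θ) + F(−θ)` doubles the jump).  The stable jump relations (all ordered pairs `i ≠ j` at compact places, constants `Σ_{σ ∈ S₃} sign σ · jc′ S′ w (σ i) (σ j)`) are option (B), banked.
HONEST LABEL: count-neutral; HC_CM is proved only modulo the 7 printed citations (2 remaining: hLiu418 = stmt-HodgeConjecture-24832, h413 = stmt-HodgeConjecture-24833) until rung 0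
closes.

## References
* [Bouaziz1994IntegralesOrbitales] A. Bouaziz, *Intégrales orbitales sur les groupes de Lie réductifs*, Ann. Sci. ÉNS (4) 27 (1994) 573–609, §3.1–3.2 pp. 579–580 ((I₁)(I₂)),
  §6.2 p. 591 (`ψ^{st}`, `T^st_{in-reg}`).
* [Shelstad1979] D. Shelstad, *Characters and inner forms of a quasi-split group over ℝ*, Compositio Math. 39 (1979) 11–45, §4 pp. 22–26, Lemma 4.2 (p. 23).
* [HormanderALPDO1] L. Hörmander, *The Analysis of Linear Partial Differential Operators I*, §1.1 Thms. 1.1.7–1.1.9 (chain and Leibniz rules for jets).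
-/

set_option autoImplicit false

noncomputable section

open Complex Finset Equiv Set
open scoped Classical ContDiff
open Literature.NumberTheory.Automorphic.ArchCartan

namespace Literature.NumberTheory.Rogawski1990

variable {W : Type*} [Fintype W] [DecidableEq W]

/-! ## §1 The pieces are smooth; the stable in-regular set is open and feeds `InRegG` through every relabelling -/

section Pieces

omit [DecidableEq W] in
/-- `StInRegG S′` is open. [cite: Bouaziz1994IntegralesOrbitales, §6.2 p. 591] -/
theorem isOpen_stInRegG (S' : Finset W) : IsOpen (StInRegG S' : Set (W → Fin 3 → ℝ)) := by
  have h : StInRegG S' = ⋂ w ∈ ((↑S' : Set W)ᶜ), {c : W → Fin 3 → ℝ | Function.Injective fun i : Fin 3 => Circle.exp (c w i)} := by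
    ext c
    simp only [StInRegG, mem_setOf_eq, mem_iInter, mem_compl_iff, Finset.mem_coe]
  rw [h]
  exact (Set.toFinite _).isOpen_biInter fun w _ => isOpen_setOf_injective_circleExp w

omit [DecidableEq W] in
/-- The relabelling `slotPerm ρ` is `C^∞` (linear). [cite: Shelstad1979, Lemma 4.2 (p. 23)] -/
theorem contDiff_slotPerm (ρ : W → Perm (Fin 3)) : ContDiff ℝ ∞ (slotPerm ρ : (W → Fin 3 → ℝ) → W → Fin 3 → ℝ) :=
  contDiff_pi.2 fun w => contDiff_pi.2 fun i => contDiff_apply_apply ℝ ℝ w (ρ w i)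

omit [DecidableEq W] in
/-- `c ↦ e^{i f(c)}` is `C^∞` for `f` `C^∞` (as a complex number). [cite: Rogawski1990, §3.6 p. 31] -/
theorem contDiff_coe_circleExp_of_contDiff {f : (W → Fin 3 → ℝ) → ℝ} (hf : ContDiff ℝ ∞ f) : ContDiff ℝ ∞ fun c : W → Fin 3 → ℝ => (Circle.exp (f c) : ℂ) := by
  have h : (fun c : W → Fin 3 → ℝ => (Circle.exp (f c) : ℂ)) = fun c => Complex.exp ((f c : ℂ) * I) := by
    funext c; exact Circle.coe_exp _
  rw [h]
  exact contDiff_cexp_comp ((Complex.ofRealCLM.contDiff.comp hf).mul contDiff_const)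

/-- The twist factor at a compact place, spelled in `ℂ`: `e^{ia}·(e^{ib})⁻¹ = e^{ia}·e^{−ib}`. [cite: Shelstad1979, §4 p. 24] -/
theorem coe_circleExp_mul_inv (a b : ℝ) : (((Circle.exp a * (Circle.exp b)⁻¹ : Circle)) : ℂ) = (Circle.exp a : ℂ) * (Circle.exp (-b) : ℂ) := by
  rw [Circle.coe_mul, ← Circle.exp_neg]

/-- **The unit twist `u_ρ` is entire.** [cite: Shelstad1979, §4 p. 24] [cite: Bouaziz1994IntegralesOrbitales, §6.2 p. 591] -/
theorem contDiff_stableTwistG (S' : Finset W) (ρ : W → Perm (Fin 3)) : ContDiff ℝ ∞ (stableTwistG S' ρ : (W → Fin 3 → ℝ) → ℂ) := by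
  unfold stableTwistG
  refine contDiff_const.mul (contDiff_prod fun w _ => ?_)
  by_cases hw : w ∈ S'
  · simp only [if_pos hw]
    exact contDiff_const
  · simp only [if_neg hw, coe_circleExp_mul_inv]
    exact (contDiff_coe_circleExp_of_contDiff ((contDiff_coord w (ρ w 0)).sub (contDiff_coord w (ρ w 2)))).mul
      (contDiff_coe_circleExp_of_contDiff ((contDiff_coord w 0).sub (contDiff_coord w 2)).neg)

omit [Fintype W] [DecidableEq W] in
/-- Every partner point of a stable-in-regular point is in-regular, for every sign pattern. [cite: Bouaziz1994IntegralesOrbitales, §6.2 p. 591] -/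
theorem stInRegG_mapsTo_inRegG_slotPerm (s : W → Fin 3 → SignType) (S' : Finset W) (ρ : W → Perm (Fin 3)) :
    MapsTo (slotPerm ρ) (StInRegG S') (InRegG s S') :=
  fun c hc => stInRegG_subset_inRegG s S' ((slotPerm_mem_stInRegG_iff c).2 hc)

/-- One partner term is `C^∞` on `StInRegG S′` when `F S′` is `C^∞` on `InRegG s S′`. [cite: Bouaziz1994IntegralesOrbitales, §3.1 (I₂) p. 579; §6.2 p. 591] -/
theorem contDiffOn_stableTwistG_mul_comp_slotPerm {s : W → Fin 3 → SignType} {F : Finset W → (W → Fin 3 → ℝ) → ℂ} {S' : Finset W}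
    (hs : ContDiffOn ℝ ∞ (F S') (InRegG s S')) (ρ : W → Perm (Fin 3)) :
    ContDiffOn ℝ ∞ (fun c : W → Fin 3 → ℝ => stableTwistG S' ρ c * F S' (slotPerm ρ c)) (StInRegG S') :=
  (contDiff_stableTwistG S' ρ).contDiffOn.mul (hs.comp (contDiff_slotPerm ρ).contDiffOn (stInRegG_mapsTo_inRegG_slotPerm s S' ρ))

end Pieces

/-! ## §2 (I₂)^st: the stable sum is `C^∞` on the stable in-regular set -/

section Smooth

/-- **(I₂)^st — `stableSumG F S′` IS `C^∞` ON `StInRegG S′`** whenever every `F S′` is `C^∞` on `InRegG s S′` (any `s`): each of the `6^{#compact}` partner terms is the entire unit twist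
times `F S′ ∘ slotPerm ρ`, and `slotPerm ρ` maps `StInRegG S′` into `InRegG s S′`.  (Not on `InRegG s S′`: the stable sum jumps across the compact walls — module docstring (F1).)
[cite: Bouaziz1994IntegralesOrbitales, §3.1 (I₂) p. 579; §6.2 p. 591] [cite: Shelstad1979, §4 p. 23] -/
theorem contDiffOn_stableSumG {s : W → Fin 3 → SignType} {F : Finset W → (W → Fin 3 → ℝ) → ℂ} (hs : ∀ S' : Finset W, ContDiffOn ℝ ∞ (F S') (InRegG s S'))
    (S' : Finset W) : ContDiffOn ℝ ∞ (stableSumG F S') (StInRegG S') := by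
  have hfun : stableSumG F S' = fun c => ∑ ρ ∈ partnerPerms S', stableTwistG S' ρ c * F S' (slotPerm ρ c) := rfl
  rw [hfun]
  exact ContDiffOn.sum fun ρ _ => contDiffOn_stableTwistG_mul_comp_slotPerm (hs S') ρ

/-- (I₂)^st for a family with Bouaziz's clause (I₁)+(I₂). [cite: Bouaziz1994IntegralesOrbitales, §3.1 (I₂) p. 579; §6.2 p. 591] -/
theorem ArchHcSmoothOneSided.contDiffOn_stableSumG {s : W → Fin 3 → SignType} {F : Finset W → (W → Fin 3 → ℝ) → ℂ} (h : ArchHcSmoothOneSided s F) (S' : Finset W) :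
    ContDiffOn ℝ ∞ (stableSumG F S') (StInRegG S') :=
  Literature.NumberTheory.Rogawski1990.contDiffOn_stableSumG (fun S' => (h S').1) S'

/-- (I₂)^st read on the regular set `RegG S′ ⊆ StInRegG S′`. [cite: Bouaziz1994IntegralesOrbitales, §3.1 (I₂) p. 579] -/
theorem contDiffOn_stableSumG_regG {s : W → Fin 3 → SignType} {F : Finset W → (W → Fin 3 → ℝ) → ℂ} (hs : ∀ S' : Finset W, ContDiffOn ℝ ∞ (F S') (InRegG s S'))
    (S' : Finset W) : ContDiffOn ℝ ∞ (stableSumG F S') (RegG S') :=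
  (contDiffOn_stableSumG hs S').mono (regG_subset_stInRegG S')

end Smooth

/-! ## §3 (I₁)^st: bounded jets on `K ∩ StInRegG S′` -/

section Bounds

/-- The jets of the entire unit twist are bounded on every compact set. [cite: HormanderALPDO1, §1.1 Thm. 1.1.8] -/
theorem bddAbove_norm_iteratedFDeriv_stableTwistG (S' : Finset W) (ρ : W → Perm (Fin 3)) (i : ℕ) {K : Set (W → Fin 3 → ℝ)} (hK : IsCompact K) :
    BddAbove ((fun c => ‖iteratedFDeriv ℝ i (stableTwistG S' ρ) c‖) '' K) :=
  (hK.image_of_continuousOn (((contDiff_stableTwistG S' ρ).continuous_iteratedFDeriv (by exact_mod_cast le_top)).norm.continuousOn)).bddAbove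

/-- **THE SUM RULE ON THE OPEN SET**: at a stable-in-regular point the `n`-jet of `stableSumG F S′` is the sum of the `n`-jets of the partner terms.
[cite: HormanderALPDO1, §1.1 Thm. 1.1.7] [cite: Bouaziz1994IntegralesOrbitales, §6.2 p. 591] -/
theorem iteratedFDeriv_stableSumG_eq_sum {s : W → Fin 3 → SignType} {F : Finset W → (W → Fin 3 → ℝ) → ℂ} {S' : Finset W}
    (hs : ContDiffOn ℝ ∞ (F S') (InRegG s S')) (n : ℕ) {c : W → Fin 3 → ℝ} (hc : c ∈ StInRegG S') :
    iteratedFDeriv ℝ n (stableSumG F S') c = ∑ ρ ∈ partnerPerms S', iteratedFDeriv ℝ n (fun c : W → Fin 3 → ℝ => stableTwistG S' ρ c * F S' (slotPerm ρ c)) c := by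
  have hO := isOpen_stInRegG S'
  have hfun : stableSumG F S' = fun c => ∑ ρ ∈ partnerPerms S', stableTwistG S' ρ c * F S' (slotPerm ρ c) := rfl
  rw [hfun, ← iteratedFDerivWithin_of_isOpen n hO hc]
  have h := iteratedFDerivWithin_sum_apply (i := n) (u := partnerPerms S')
    (f := fun ρ (c : W → Fin 3 → ℝ) => stableTwistG S' ρ c * F S' (slotPerm ρ c)) hO.uniqueDiffOn hc
    fun ρ _ => ((contDiffOn_stableTwistG_mul_comp_slotPerm hs ρ) c hc).of_le (by exact_mod_cast le_top)
  have hsum : (∑ ρ ∈ partnerPerms S', fun c : W → Fin 3 → ℝ => stableTwistG S' ρ c * F S' (slotPerm ρ c)) =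
      fun c => ∑ ρ ∈ partnerPerms S', stableTwistG S' ρ c * F S' (slotPerm ρ c) := by
    funext c; simp only [Finset.sum_apply]
  rw [hsum] at h
  rw [h]
  exact Finset.sum_congr rfl fun ρ _ => iteratedFDerivWithin_of_isOpen n hO hc

/-- **(I₁)^st — EVERY JET OF `stableSumG F S′` IS BOUNDED ON `K ∩ StInRegG S′`, `K` COMPACT**, as soon as `F S′` is `C^∞` on `InRegG s S′` with jets bounded on `K′ ∩ InRegG s S′` for
every compact `K′` (Bouaziz (I₁) for `F`).  Bound = `Σ_ρ Σ_{i ≤ n} C(n,i) · sup_K ‖Dⁱ u_ρ‖ · ‖A_ρ‖^{n−i} · sup_{ρ·K ∩ InRegG} ‖D^{n−i} F S′‖` (Leibniz, linear pull-back along the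
relabelling `A_ρ = slotPerm ρ`, sum rule on the open `StInRegG S′`). [cite: Bouaziz1994IntegralesOrbitales, §3.1 (I₁) p. 579; §6.2 p. 591] [cite: Shelstad1979, §4 pp. 22–25]
[cite: HormanderALPDO1, §1.1 Thms. 1.1.7–1.1.9] -/
theorem bddAbove_norm_iteratedFDeriv_stableSumG {s : W → Fin 3 → SignType} {F : Finset W → (W → Fin 3 → ℝ) → ℂ} {S' : Finset W}
    (hs : ContDiffOn ℝ ∞ (F S') (InRegG s S'))
    (hb : ∀ (n : ℕ) (K : Set (W → Fin 3 → ℝ)), IsCompact K → BddAbove ((fun c => ‖iteratedFDeriv ℝ n (F S') c‖) '' (K ∩ InRegG s S')))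
    (n : ℕ) {K : Set (W → Fin 3 → ℝ)} (hK : IsCompact K) :
    BddAbove ((fun c => ‖iteratedFDeriv ℝ n (stableSumG F S') c‖) '' (K ∩ StInRegG S')) := by
  have hO := isOpen_stInRegG S'
  -- the relabellings as continuous linear maps
  choose P hP using fun ρ : W → Perm (Fin 3) => exists_continuousLinearEquiv_eq_slotPerm (W := W) ρ
  -- the two families of constants: twist jets on `K`, `F`-jets on the partner images `slotPerm ρ '' K ∩ InRegG`
  set M : (W → Perm (Fin 3)) → ℕ → ℝ := fun ρ i => sSup ((fun c => ‖iteratedFDeriv ℝ i (stableTwistG S' ρ) c‖) '' K) with hM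
  set B : (W → Perm (Fin 3)) → ℕ → ℝ := fun ρ m => sSup ((fun c => ‖iteratedFDeriv ℝ m (F S') c‖) '' (slotPerm ρ '' K ∩ InRegG s S')) with hB
  have hKρ : ∀ ρ : W → Perm (Fin 3), IsCompact (slotPerm ρ '' K) := fun ρ => hK.image (continuous_slotPerm ρ)
  refine ⟨∑ ρ ∈ partnerPerms S', ∑ i ∈ Finset.range (n + 1), (n.choose i : ℝ) * M ρ i * (‖(P ρ : (W → Fin 3 → ℝ) →L[ℝ] (W → Fin 3 → ℝ))‖ ^ (n - i) * B ρ (n - i)), ?_⟩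
  rintro _ ⟨c, ⟨hcK, hcU⟩, rfl⟩
  show ‖iteratedFDeriv ℝ n (stableSumG F S') c‖ ≤ _
  rw [iteratedFDeriv_stableSumG_eq_sum hs n hcU]
  refine (norm_sum_le _ _).trans (Finset.sum_le_sum fun ρ _ => ?_)
  -- Leibniz for the partner term `u_ρ · (F S′ ∘ slotPerm ρ)` on the open `StInRegG S′`
  have hcomp : ContDiffOn ℝ ∞ (fun c : W → Fin 3 → ℝ => F S' (slotPerm ρ c)) (StInRegG S') :=
    hs.comp (contDiff_slotPerm ρ).contDiffOn (stInRegG_mapsTo_inRegG_slotPerm s S' ρ)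
  refine (norm_iteratedFDeriv_mul_le_of_isOpen hO (contDiff_stableTwistG S' ρ).contDiffOn hcomp hcU n).trans (Finset.sum_le_sum fun i hi => ?_)
  -- the twist jet
  have h1 : ‖iteratedFDeriv ℝ i (stableTwistG S' ρ) c‖ ≤ M ρ i :=
    le_csSup (bddAbove_norm_iteratedFDeriv_stableTwistG S' ρ i hK) (mem_image_of_mem _ hcK)
  have hM0 : 0 ≤ M ρ i := (norm_nonneg _).trans h1
  -- the pulled-back jet of `F S′`
  have h2 : ‖iteratedFDeriv ℝ (n - i) (fun c : W → Fin 3 → ℝ => F S' (slotPerm ρ c)) c‖ ≤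
      ‖(P ρ : (W → Fin 3 → ℝ) →L[ℝ] (W → Fin 3 → ℝ))‖ ^ (n - i) * B ρ (n - i) := by
    have hfun : (fun c : W → Fin 3 → ℝ => F S' (slotPerm ρ c)) = fun c => F S' ((P ρ : (W → Fin 3 → ℝ) →L[ℝ] (W → Fin 3 → ℝ)) c + 0) := by
      funext c'; rw [add_zero, ContinuousLinearEquiv.coe_coe, hP ρ c']
    rw [hfun]
    have hx : (P ρ : (W → Fin 3 → ℝ) →L[ℝ] (W → Fin 3 → ℝ)) c + 0 ∈ InRegG s S' := by
      rw [add_zero, ContinuousLinearEquiv.coe_coe, hP ρ c]; exact stInRegG_mapsTo_inRegG_slotPerm s S' ρ hcU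
    refine (norm_iteratedFDeriv_comp_clm_add_le (isOpen_inRegG s S') hs _ 0 hx (n - i)).trans (mul_le_mul_of_nonneg_left ?_ (pow_nonneg (norm_nonneg _) _))
    rw [add_zero, ContinuousLinearEquiv.coe_coe, hP ρ c]
    exact le_csSup (hb (n - i) _ (hKρ ρ)) (mem_image_of_mem _ ⟨mem_image_of_mem _ hcK, stInRegG_mapsTo_inRegG_slotPerm s S' ρ hcU⟩)
  have hB0 : 0 ≤ ‖(P ρ : (W → Fin 3 → ℝ) →L[ℝ] (W → Fin 3 → ℝ))‖ ^ (n - i) * B ρ (n - i) := (norm_nonneg _).trans h2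
  calc (n.choose i : ℝ) * ‖iteratedFDeriv ℝ i (stableTwistG S' ρ) c‖ * ‖iteratedFDeriv ℝ (n - i) (fun c : W → Fin 3 → ℝ => F S' (slotPerm ρ c)) c‖
      ≤ (n.choose i : ℝ) * M ρ i * (‖(P ρ : (W → Fin 3 → ℝ) →L[ℝ] (W → Fin 3 → ℝ))‖ ^ (n - i) * B ρ (n - i)) :=
        mul_le_mul (mul_le_mul_of_nonneg_left h1 (Nat.cast_nonneg _)) h2 (norm_nonneg _) (mul_nonneg (Nat.cast_nonneg _) hM0)

/-- (I₁)^st for a family with Bouaziz's clause (I₁)+(I₂), every chart, every order, every compact. [cite: Bouaziz1994IntegralesOrbitales, §3.1 (I₁) p. 579; §6.2 p. 591] -/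
theorem ArchHcSmoothOneSided.bddAbove_norm_iteratedFDeriv_stableSumG {s : W → Fin 3 → SignType} {F : Finset W → (W → Fin 3 → ℝ) → ℂ} (h : ArchHcSmoothOneSided s F)
    (S' : Finset W) (n : ℕ) {K : Set (W → Fin 3 → ℝ)} (hK : IsCompact K) :
    BddAbove ((fun c => ‖iteratedFDeriv ℝ n (stableSumG F S') c‖) '' (K ∩ StInRegG S')) :=
  Literature.NumberTheory.Rogawski1990.bddAbove_norm_iteratedFDeriv_stableSumG (h S').1 (fun n K hK => (h S').2.1 n K hK) n hK

end Bounds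

/-! ## §4 The package for a member of `ArchHCSpaceG s jc′` -/

section Package

/-- **THE STABLE SUM OF A HARISH-CHANDRA FAMILY — ALL THE (A)-CLAUSES AT ONCE.**  For `F ∈ ArchHCSpaceG s jc′`: `stableSumG F` is angle-periodic (P), STABLY Weyl-symmetric (W^st)
(every transposition at every compact place, division-free twisted form; `x`-even), compactly supported modulo conjugacy (I₄), `C^∞` on `StInRegG S′` with all jets bounded on
`K ∩ StInRegG S′` for every chart `S′`, order `n`, compact `K` ((I₁)(I₂) on Bouaziz's STABLE in-regular set).  NOT claimed: membership in `ArchHCSpaceG s jc′` (false — module docstring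
(F1)(F2)); the stable jump relations (option (B), banked). [cite: Bouaziz1994IntegralesOrbitales, §3.1–3.2 pp. 579–580; §6.2 p. 591] [cite: Shelstad1979, §4 pp. 22–26; Lemma 4.2 (p. 23)] -/
theorem stableSumG_clauses_of_archHCSpaceG {s : W → Fin 3 → SignType} {jc' : Finset W → W → Fin 3 → Fin 3 → ℂ} {F : Finset W → (W → Fin 3 → ℝ) → ℂ}
    (hF : ArchHCSpaceG s jc' F) :
    ArchHcPeriodic (stableSumG F) ∧ ArchHcStableWeyl (stableSumG F) ∧ ArchHcCompactSupport (stableSumG F) ∧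
      (∀ S' : Finset W, ContDiffOn ℝ ∞ (stableSumG F S') (StInRegG S')) ∧
      ∀ (S' : Finset W) (n : ℕ) (K : Set (W → Fin 3 → ℝ)), IsCompact K → BddAbove ((fun c => ‖iteratedFDeriv ℝ n (stableSumG F S') c‖) '' (K ∩ StInRegG S')) := by
  obtain ⟨hP, hW, hS, hC, -⟩ := hF
  exact ⟨archHcPeriodic_stableSumG hP, archHcStableWeyl_stableSumG hW.2, archHcCompactSupport_stableSumG hC, fun S' => hS.contDiffOn_stableSumG S',
    fun S' n K hK => hS.bddAbove_norm_iteratedFDeriv_stableSumG S' n hK⟩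

/-- **The image reading of (D2) v2**: for a member `F`, on the regular set the stable sum of the stable sum is the positive multiple `|partnerPerms S′| · stableSumG F S′` — the IMAGE
`{stableSumG F | F ∈ ArchHCSpaceG s jc′}` is reproduced by `stableSumG` up to `6^{#(univ ∖ S′)}` (idempotence ★-cand `stableSumG_stableSumG_of_mem_regG`).
[cite: Shelstad1979, Lemma 4.2 (p. 23)] [cite: Rogawski1990, §4.3 (4.3.1) p. 43] -/
theorem stableSumG_stableSumG_of_archHCSpaceG {s : W → Fin 3 → SignType} {jc' : Finset W → W → Fin 3 → Fin 3 → ℂ} {F : Finset W → (W → Fin 3 → ℝ) → ℂ}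
    (hF : ArchHCSpaceG s jc' F) {S' : Finset W} {c : W → Fin 3 → ℝ} (hc : c ∈ RegG S') :
    stableSumG (stableSumG F) S' c = ((partnerPerms S').card : ℂ) * stableSumG F S' c :=
  stableSumG_stableSumG_of_mem_regG hF.2.1.2 hc

end Package

end Literature.NumberTheory.Rogawski1990

end
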